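import Mathlib

/-!
# LINE 14 — the FIBRE LAW (character–coincidence law) for letter complexes — negation lens, crux `BlochSeedDiscOne` (stmt-HodgeConjecture-18881)

plan-lens-HodgeAV-negation g13 (rev 1.3: + §7 alphabet transfer to Mukai's simple semi-homogeneous letters, `c₁ ↦ δ = c₁/r`, rank-weighted kernel vectors).  Mathlib-only kernel: finite models and exact bookkeeping; NOTHING here proves HC, HC_CM,
HC_AV, the sub-statement H2 = `BlochSeedDiscOne` (`HasHyperbolicBlochSeed 4 1`) or item 18881; HC_CM is not used.

THE LAW (pen, four lines on top of LINE 13 LAW (ii), `Cruxes/BlochSeedDiscOne/LetterTraceLaw.lean`).  For 𝓔 = H(K) the cohomology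
of a finite complex of LETTERS on X = E₁² × E₂² × E₃² × E₄² (line bundles L_x, Pic⁰-twisted or ⊠-typed with flat types), every
semiregularity component reads the column-0 diagonal cell `Diag_x[k] = H²(𝒪_X)[k] ⊗ End ℂ^{m_x}` only through the LETTER CHARACTER
`χ_{x,k} : H²(𝒪_X)[k] → ⊕_q H^{q+2}(Ω^q),  ω ↦ (ω ∪ ch_q(L_x))_q`,   σ_q(ω ⊗ M) = ± tr(M) · χ_{x,k}(ω)_q.
(iv) COINCIDENCE.  χ_{x,k} = χ_{x′,k}  ⟺  δ := c₁(L_{x′}) − c₁(L_x) is supported on the factors f with k_f = 2.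
  Proof: ω ∪ (e^{c₁(x′)} − e^{c₁(x)}) = ω ∪ e^{c₁(x)} ∪ (e^{δ} − 1) with e^{c₁(x)} and (e^{δ}−1)/δ invertible, so coincidence ⟺ ω ∪ δ_g = 0
  for every factor g and every ω ∈ H^{0,2}[k]; on a SURFACE factor (0,k_g) + (1,1) vanishes iff k_g = 2 (§1 `mul_add_pow_eq`, §2); for
  k_g = 1 the pairing H^{0,1}(A_g) ⊗ H^{1,1}(A_g) → H^{1,2}(A_g) has no right kernel (§1 `eq_zero_of_wedge01_eq_zero`); k_g = 0 is trivial.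
  So the coincidence classes are exactly: (a) at a PURE multidegree k = 2e_f, the f-FIBRES Φ = {letters with the same classes OFF factor f}
  (any side of the complex, any Pic⁰ label, any flat ⊠-type); (b) at every k, the same-class TWINS (equal classes, different label/type/side).
(v) POOLED ROWS.  On ⊕_{x∈Φ} Diag_x[k] (dimension h[k]·S2(Φ), S2(Φ) = Σ_{x∈Φ} m_x²) the σ-image has rank ≤ h[k] (one character for the whole
  class), so with the survival bookkeeping of c4-1 LEMMA Σ-DIAG (one-step live targets L, sources L̄; monads add LINE 13's two-step OUT/IN)
  I-semiregularity of 𝓔_φ (any I, every φ realising the live graph) requires                                           (§3 `rowF_survivors`)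
      ROW F  (k = 2e_f, Φ an f-fibre):        S2(Φ) − 1        ≤ L_{2e_f}(Φ) + L̄_{2e_f}(Φ)  (+ OUT + IN),
      ROW TW (any k, Φ a twin class):     h[k]·(S2(Φ) − 1)     ≤ L_k(Φ) + L̄_k(Φ)            (+ OUT + IN).
  LINE 13's ROW T is the singleton case Φ = {s}; ROW F gains |Φ| − 1 over the conjunction of the members' ROW T.
(vi) WHICH ARROWS REACH A PURE CELL.  A live arrow x → y contributes to L_{2e_f} at x iff y − x is TRIVIAL on factor f («f-zero arrow»:
  closedness defect H⁰ ⊗ H²(𝒪_{A_f})) and to L̄_{2e_f} iff y − x is trivial OFF f («f-pure arrow»: exactness defect H²(A_f, x−y) ⊗ H⁰).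
  (A2F) := the design has no f-zero and no f-pure live arrow (implied by (A4♯), (A4), (A3): a 4- or 3-ample arrow is neither).
(vii) THE FORCED SHAPE (negation lens: assume a seed carrier of this kind exists).  Under (A2F): every f-fibre is a singleton of multiplicity
  one, i.e. THE LETTER SUPPORT (all sides together) IS A CODE OF MINIMUM HAMMING DISTANCE ≥ 2 over the per-factor alphabets (§4), and under
  (A4♯) every class carries at most one label/type (ROW TW).  Encodable by the LP/ILP seats as packing cuts Σ_{x ∈ ℓ} m_x ≤ 1 for every
  axis-parallel line ℓ of cells.  The colour-1 rotation group S₀ = {k ∈ (ℤ/4)⁴ : Σ k_f ≡ 0} has no element of weight one, so S₀-orbits ARE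
  distance-2 codes PROVIDED the base cell is off-axis (sloped) on EVERY factor (§5 free rotation model, `S0_orbit_distance_ge_two`; with an
  on-axis letter on some factor an S₀-rotation can produce a twin, `onAxis_counterexample` — critic rider w1), while a design invariant under
  the full (ℤ/4)⁴ with off-axis cells contains f-twins.
(viii) OUTSIDE THE CENSUS (cheapest external falsifier).  A complete intersection W = D ∩ D′ of two ample divisors on A_f × X′ (A_f an
  abelian surface) with c₁(D′) − c₁(D) pulled back from A_f is NOT semiregular: its Koszul complex is the two-term design P = {−D−D′},
  N = {−D, −D′} whose N-letters form an f-fibre with no defects, kernel vector ω_f ⊗ (e_D − e_{D′}) (pen: π(ω_f, −ω_f) = ω_f ∪ (c₁(D′) − c₁(D)) = 0,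
  Bloch's cup-product form of π for complete intersections), although dim H¹(N_W) ≤ dim H³(Ω¹) when h⁰(δ) ≤ 2 (§6 `ci_dimension_test_inconclusive`).

Sources: LINE 13 `LetterTraceLaw.lean` 96693e7a (LAW (i)(ii), ROW T), c4-1 `SigmaRowSpec.lean` / memo `C4-EXT2-COUNT-c4-1-g5.md` §12.2 (Σ-DIAG),
`C4-DEGENERACY-LOCI-c4-1-g2.md` §4.3 (DL₀: unobstructedness necessary for both doors — the bracket form of f-twins, card §Mechanism),
strengthen `DepthBoundA4.lean` (S₀, ONE-ORBIT), embed-2 `B4DoorCount.lean`; Huybrechts–Lehn §10.1.5; Buchweitz–Flenner 2003; Bloch 1972.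
-/

set_option linter.dupNamespace false

namespace Summit.HodgeConjecture.HodgeConjecture.Cruxes.BlochSeedDiscOne.FibreLaw

open Matrix

section CharacterCoincidence
/-! ## §1  The algebra of LAW (iv).  In the (commutative, even) cohomology ring: if `ω ∪ δ = 0` then `ω ∪ (c + δ)^q = ω ∪ c^q`
for every `q` — the letter character `ω ↦ (ω ∪ c₁(L_x)^q / q!)_q` at a class `ω` killing `δ = c₁(L_{x′}) − c₁(L_x)` does not separate
`x` from `x′`.  On a surface factor `A_f`, `ω_f ∈ H^{0,2}(A_f)` kills every `δ_f ∈ H^{1,1}(A_f)` (bidegree `(1,3)`), which is the pure-cell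
case; the converse direction on a factor with `k_g = 1` is the non-degeneracy of `H^{0,1} ⊗ H^{1,1} → H^{1,2}` in coordinates. -/

variable {R : Type*} [CommRing R]

/-- `ω·δ = 0 ⇒ ω·(c+δ)^q = ω·c^q`: the character at `ω` is blind to `δ`. -/
theorem mul_add_pow_eq_of_mul_eq_zero (ω c δ : R) (h : ω * δ = 0) (q : ℕ) :
    ω * (c + δ) ^ q = ω * c ^ q := by
  induction q with
  | zero => simp
  | succ n ih =>
    calc ω * (c + δ) ^ (n + 1) = (ω * (c + δ) ^ n) * (c + δ) := by ring
      _ = (ω * c ^ n) * (c + δ) := by rw [ih]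
      _ = ω * c ^ (n + 1) + c ^ n * (ω * δ) := by ring
      _ = ω * c ^ (n + 1) := by rw [h]; ring

/-- The same with any polynomial weight in front (e.g. the common off-`f` factor `e^{c_rest}`): characters of an `f`-fibre coincide. -/
theorem mul_mul_add_pow_eq_of_mul_eq_zero (ω a c δ : R) (h : ω * δ = 0) (q : ℕ) :
    ω * a * (c + δ) ^ q = ω * a * c ^ q := by
  have := mul_add_pow_eq_of_mul_eq_zero ω c δ h q
  calc ω * a * (c + δ) ^ q = a * (ω * (c + δ) ^ q) := by ring
    _ = a * (ω * c ^ q) := by rw [this]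
    _ = ω * a * c ^ q := by ring

/-- Difference form used for the kernel vector `ω ⊗ (e_x − e_{x′})`: all components `σ_q` vanish on it. -/
theorem character_difference_eq_zero (ω c δ : R) (h : ω * δ = 0) (q : ℕ) :
    ω * (c + δ) ^ q - ω * c ^ q = 0 := by
  rw [mul_add_pow_eq_of_mul_eq_zero ω c δ h q, sub_self]

/-- Converse ingredient on a factor with `k_g = 1` (surface `A_g`, coordinates `dz₁,dz₂`): the wedge pairing of a `(0,1)`-class
`a = a₁ dz̄₁ + a₂ dz̄₂` with a `(1,1)`-class `c = Σ c_{ij} dz_i ∧ dz̄_j` has `dz_i ∧ dz̄₁ ∧ dz̄₂`-coefficient `c_{i1} a₂ − c_{i2} a₁`;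
if it vanishes for every `a` then `c = 0` — so at mixed multidegrees distinct classes have distinct characters. -/
theorem eq_zero_of_wedge01_eq_zero {K : Type*} [CommRing K] (c : Fin 2 → Fin 2 → K)
    (h : ∀ a : Fin 2 → K, ∀ i : Fin 2, c i 0 * a 1 - c i 1 * a 0 = 0) : c = 0 := by
  funext i j
  have h1 := h ![0, 1] i
  have h2 := h ![1, 0] i
  simp at h1 h2
  fin_cases j <;> simp [h1, h2]

end CharacterCoincidence

section Bidegrees
/-! ## §2  The coincidence pattern per multidegree.  `k : Fin 4 → Fin 3` = antiholomorphic degrees per surface factor, `|k| = 2`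
(ten multidegrees: four PURE `2e_f`, six MIXED `e_f + e_g`).  `ω ∪ δ_g` has factor-`g` bidegree `(1, k_g + 1)`, which vanishes on a
surface iff `k_g + 1 > 2` iff `k_g = 2`.  So the COINCIDENCE SUPPORT `{g : k_g = 2}` is `{f}` at the pure `2e_f` and `∅` at every mixed `k`:
two letters share a character at `k` iff they differ only inside the coincidence support (pure: same classes off `f`; mixed: equal). -/

def pureKs : List (Fin 4 → Fin 3) := [![2,0,0,0], ![0,2,0,0], ![0,0,2,0], ![0,0,0,2]]
def mixedKs : List (Fin 4 → Fin 3) := [![1,1,0,0], ![1,0,1,0], ![1,0,0,1], ![0,1,1,0], ![0,1,0,1], ![0,0,1,1]]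

/-- factor `g` is in the coincidence support of `k` iff the bidegree `(1, k_g + 1)` leaves the surface range. -/
def coincides (k : Fin 4 → Fin 3) (g : Fin 4) : Bool := decide (2 < (k g).val + 1)

theorem coincides_iff (k : Fin 4 → Fin 3) (g : Fin 4) : coincides k g = true ↔ (k g).val = 2 := by
  unfold coincides; have := (k g).isLt; simp; omega

/-- every `|k| = 2` multidegree is pure or mixed -/
theorem ks2_complete : ∀ k : Fin 4 → Fin 3, (k 0).val + (k 1).val + (k 2).val + (k 3).val = 2 →
    k ∈ pureKs ∨ k ∈ mixedKs := by decide

/-- PURE `k = 2e_f`: the coincidence support is exactly `{f}` (characters see only the classes OFF `f`). -/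
theorem coincidenceSupport_pure :
    (∀ g, coincides ![2,0,0,0] g = decide (g = 0)) ∧ (∀ g, coincides ![0,2,0,0] g = decide (g = 1)) ∧
    (∀ g, coincides ![0,0,2,0] g = decide (g = 2)) ∧ (∀ g, coincides ![0,0,0,2] g = decide (g = 3)) := by decide

/-- MIXED `k`: empty coincidence support (distinct classes ⇒ distinct characters; only same-class twins pool). -/
theorem coincidenceSupport_mixed : ∀ k ∈ mixedKs, ∀ g, coincides k g = false := by decide

/-- trace codimension of the pooled cell: `h[k] = 1` on pure, `4` on mixed `k` (LINE 13 §2b, recalled for ROW TW). -/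
def hFactor : Fin 3 → ℕ := ![1, 2, 1]
def hK (k : Fin 4 → Fin 3) : ℕ := hFactor (k 0) * hFactor (k 1) * hFactor (k 2) * hFactor (k 3)
theorem hK_pure : ∀ k ∈ pureKs, hK k = 1 := by decide
theorem hK_mixed : ∀ k ∈ mixedKs, hK k = 4 := by decide

/-- (vi) which live arrows reach the pure cell `Diag_x[2e_f]`: with per-factor cohomology `(h⁰,h¹,h²)(A_g, (y−x)_g)` of a LIVE arrow
(`h⁰ > 0` on every factor, hence `h² = 0` unless the factor difference is trivial, where it is `(1,2,1)`), the target block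
`H²(y−x)[2e_f] = h²_f · ∏_{g≠f} h⁰_g` is non-zero iff factor `f` is trivial («f-zero arrow»), and the source block `H²(x−y)[2e_f] =
h²(A_f,(x−y)_f) · ∏_{g≠f} h⁰(A_g,(x−y)_g)` is non-zero iff every `g ≠ f` is trivial («f-pure arrow»), since `h⁰(−effective) = 0`
unless the class is trivial.  Finite statement of the first half: -/
theorem pure_target_block_zero_of_h2_zero (h0 : Fin 4 → ℕ) (h2f : ℕ) (hf : h2f = 0) (f : Fin 4) :
    h2f * ((Finset.univ.erase f).prod h0) = 0 := by subst hf; simp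

end Bidegrees

section PooledRank
/-! ## §3  ROW F / ROW TW, counting step.  `V = ⊕_{x∈Φ} Diag_x[k]` (dimension `w = h[k]·S2(Φ)`); `σ : V → W` the restriction of all
`σ_q` (through LAW (ii) it factors through ONE character, so `rank σ ≤ r` with `r = 1` for an `f`-fibre at a pure `k`, `r = h[k]` for a
twin class); `S ≤ V` the `d₁`-closed classes (`dim S ≥ w − L`); `B ≤ V` the boundaries meeting `V` (`dim B ≤ L̄`, plus `IN` for monads).
Then `≥ max(0, w − r − L − L̄)` independent classes of `E_∞^{0,2} ⊂ Ext²(𝓔,𝓔)` lie in `ker σ_q` for every `q`; semiregularity needs this to be `0`. -/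

variable {K V W : Type*} [Field K] [AddCommGroup V] [Module K V] [FiniteDimensional K V]
  [AddCommGroup W] [Module K W]

omit [FiniteDimensional K V] in
/-- a map that factors through a functional (`v ↦ τ(v) • u`) has rank ≤ 1 — the pooled character of a fibre. -/
theorem finrank_range_smulRight_le_one (τ : V →ₗ[K] K) (u : W) :
    Module.finrank K ↥(LinearMap.range (τ.smulRight u)) ≤ 1 := by
  have hle : LinearMap.range (τ.smulRight u) ≤ Submodule.span K ({u} : Finset W) := by
    rintro _ ⟨v, rfl⟩
    simp only [Finset.coe_singleton, LinearMap.smulRight_apply]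
    exact Submodule.smul_mem _ _ (Submodule.mem_span_singleton_self u)
  calc Module.finrank K ↥(LinearMap.range (τ.smulRight u))
      ≤ Module.finrank K ↥(Submodule.span K (({u} : Finset W) : Set W)) := Submodule.finrank_mono hle
    _ ≤ ({u} : Finset W).card := finrank_span_finset_le_card _
    _ = 1 := by simp

/-- rank–nullity in the form used: `dim V − rank σ ≤ dim ker σ`. -/
theorem finrank_sub_rank_le_finrank_ker (σ : V →ₗ[K] W) (r : ℕ)
    (hr : Module.finrank K ↥(LinearMap.range σ) ≤ r) :
    Module.finrank K V - r ≤ Module.finrank K ↥(LinearMap.ker σ) := by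
  have h := LinearMap.finrank_range_add_finrank_ker σ
  omega

omit [AddCommGroup W] [Module K W] in
theorem finrank_add_le_finrank_add_finrank_inf (S T : Submodule K V) :
    Module.finrank K S + Module.finrank K T ≤ Module.finrank K V + Module.finrank K ↥(S ⊓ T) := by
  have h := Submodule.finrank_sup_add_finrank_inf_eq S T
  have h' : Module.finrank K ↥(S ⊔ T) ≤ Module.finrank K V := Submodule.finrank_le _
  omega

omit [AddCommGroup W] [Module K W] in
/-- passing to `E_∞` (quotient by the boundaries `B`) costs at most `dim B`. -/
theorem finrank_sub_finrank_le_finrank_map_mkQ (U B : Submodule K V) :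
    Module.finrank K U - Module.finrank K B ≤ Module.finrank K ↥(U.map B.mkQ) := by
  have h := LinearMap.finrank_range_add_finrank_ker (B.mkQ.comp U.subtype)
  have hr : LinearMap.range (B.mkQ.comp U.subtype) = U.map B.mkQ := by
    rw [LinearMap.range_comp, Submodule.range_subtype]
  have hk : Module.finrank K ↥(LinearMap.ker (B.mkQ.comp U.subtype)) ≤ Module.finrank K B := by
    rw [← Submodule.finrank_map_subtype_eq U (LinearMap.ker (B.mkQ.comp U.subtype)), LinearMap.ker_comp,
      Submodule.ker_mkQ, Submodule.map_comap_subtype]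
    exact Submodule.finrank_mono inf_le_right
  rw [hr] at h
  omega

/-- **ROW F / ROW TW survivors.**  `max(0, w − r − L − L̄)` independent pooled-cell classes survive (ℕ-truncated subtraction in the statement) to `E_∞^{0,2}` inside `ker σ`. -/
theorem rowF_survivors (S B : Submodule K V) (σ : V →ₗ[K] W) (w r L Lbar : ℕ)
    (hV : Module.finrank K V = w) (hσ : Module.finrank K ↥(LinearMap.range σ) ≤ r)
    (hS : w - L ≤ Module.finrank K S) (hB : Module.finrank K B ≤ Lbar) :
    w - r - L - Lbar ≤ Module.finrank K ↥((S ⊓ LinearMap.ker σ).map B.mkQ) := by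
  have h1 := finrank_add_le_finrank_add_finrank_inf S (LinearMap.ker σ)
  have h2 := finrank_sub_rank_le_finrank_ker σ r hσ
  have h3 := finrank_sub_finrank_le_finrank_map_mkQ (S ⊓ LinearMap.ker σ) B
  have h4 : Module.finrank K S ≤ Module.finrank K V := Submodule.finrank_le S
  omega

/-- **ROW F in numbers.**  If σ is injective on `Ext²` the surviving kernel classes are `0`, so `w − r ≤ L + L̄`
(pure fibre: `S2(Φ) − 1 ≤ L + L̄`; twin class: `h[k]·S2(Φ) − h[k] ≤ L + L̄`). -/
theorem rowF_inequality (S B : Submodule K V) (σ : V →ₗ[K] W) (w r L Lbar : ℕ)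
    (hV : Module.finrank K V = w) (hσ : Module.finrank K ↥(LinearMap.range σ) ≤ r)
    (hS : w - L ≤ Module.finrank K S) (hB : Module.finrank K B ≤ Lbar)
    (hkill : Module.finrank K ↥((S ⊓ LinearMap.ker σ).map B.mkQ) = 0) : w - r ≤ L + Lbar := by
  have h := rowF_survivors S B σ w r L Lbar hV hσ hS hB
  omega

/-- the pure-fibre instance: σ restricted to the fibre's cells factors through one character (`τ.smulRight u`). -/
theorem rowF_survivors_fibre (S B : Submodule K V) (τ : V →ₗ[K] K) (u : W) (w L Lbar : ℕ)
    (hV : Module.finrank K V = w) (hS : w - L ≤ Module.finrank K S) (hB : Module.finrank K B ≤ Lbar) :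
    w - 1 - L - Lbar ≤ Module.finrank K ↥((S ⊓ LinearMap.ker (τ.smulRight u)).map B.mkQ) :=
  rowF_survivors S B (τ.smulRight u) w 1 L Lbar hV (finrank_range_smulRight_le_one τ u) hS hB

end PooledRank

section DistanceTwoCode
/-! ## §4  (vii) THE FORCED SHAPE.  Cells are words `x : Fin 4 → α` (one letter per surface factor).  The `f`-fibre key forgets the
`f`-th letter.  If every fibre is a singleton (ROW F under (A2F)), two distinct cells of the support differ in at least TWO factors:
the support is a code of minimum Hamming distance ≥ 2.  Conversely an `f`-twin pair has Hamming distance 1. -/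

variable {α : Type*} [DecidableEq α]

/-- the `f`-fibre key of a cell: its letters off factor `f`. -/
def fibreKey (f : Fin 4) (x : Fin 4 → α) : Fin 4 → Option α := fun g => if g = f then none else some (x g)

omit [DecidableEq α] in
theorem fibreKey_eq_iff (f : Fin 4) (x y : Fin 4 → α) :
    fibreKey f x = fibreKey f y ↔ ∀ g, g ≠ f → x g = y g := by
  constructor
  · intro h g hg
    have := congrFun h g
    simpa [fibreKey, hg] using this
  · intro h; funext g
    by_cases hg : g = f
    · simp [fibreKey, hg]
    · simp [fibreKey, hg, h g hg]

/-- two distinct cells at Hamming distance ≤ 1 lie in a common fibre. -/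
theorem exists_fibre_of_hammingDist_le_one (x y : Fin 4 → α) (hd : hammingDist x y ≤ 1) :
    ∃ f, fibreKey f x = fibreKey f y := by
  classical
  have hcard : (Finset.univ.filter fun i => x i ≠ y i).card ≤ 1 := by simpa [hammingDist] using hd
  rcases Nat.lt_or_ge (Finset.univ.filter fun i => x i ≠ y i).card 1 with h0 | h1
  · -- no differing coordinate: x = y, any f works
    have hempty : (Finset.univ.filter fun i => x i ≠ y i) = ∅ := by
      simpa using Nat.lt_one_iff.mp h0
    refine ⟨0, (fibreKey_eq_iff 0 x y).2 fun g _ => ?_⟩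
    by_contra hne
    have : g ∈ (Finset.univ.filter fun i => x i ≠ y i) := by simp [hne]
    rw [hempty] at this; simp at this
  · -- exactly one differing coordinate f
    have hone : (Finset.univ.filter fun i => x i ≠ y i).card = 1 := le_antisymm hcard h1
    obtain ⟨f, hf⟩ := Finset.card_eq_one.mp hone
    refine ⟨f, (fibreKey_eq_iff f x y).2 fun g hg => ?_⟩
    by_contra hne
    have : g ∈ (Finset.univ.filter fun i => x i ≠ y i) := by simp [hne]
    rw [hf] at this; simp at this; exact hg this

/-- **Fibre-singleton support ⇒ distance-2 code.** -/
theorem two_le_hammingDist_of_fibre_singletons (S : Finset (Fin 4 → α))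
    (hS : ∀ f, Set.InjOn (fibreKey f) (S : Set (Fin 4 → α))) :
    ∀ x ∈ S, ∀ y ∈ S, x ≠ y → 2 ≤ hammingDist x y := by
  intro x hx y hy hxy
  by_contra hlt
  have hd : hammingDist x y ≤ 1 := by omega
  obtain ⟨f, hf⟩ := exists_fibre_of_hammingDist_le_one x y hd
  exact hxy (hS f hx hy hf)

/-- and an `f`-twin pair (same letters off `f`, different letter on `f`) has distance exactly one — what ROW F forbids under (A2F). -/
theorem hammingDist_eq_one_of_twin (f : Fin 4) (x y : Fin 4 → α)
    (hoff : ∀ g, g ≠ f → x g = y g) (hon : x f ≠ y f) : hammingDist x y = 1 := by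
  classical
  have : (Finset.univ.filter fun i => x i ≠ y i) = {f} := by
    ext g; by_cases hg : g = f
    · subst hg; simp [hon]
    · simp [hg, hoff g hg]
  simp [hammingDist, this]

end DistanceTwoCode

section RotationGroups
/-! ## §5  S₀ versus the full rotation group.  colour-1's `S₀ = {k ∈ (ℤ/4)⁴ : Σ_f k_f = 0}` (strengthen `DepthBoundA4.lean`) has no
element of weight one, so two cells of one S₀-orbit never differ on exactly one factor: S₀-ORBITS ARE DISTANCE-2 CODES and pass ROW F's
shape test by themselves (an independent reason for S₀).  The full `(ℤ/4)⁴` contains `e_f`, and `e_f` moves an off-axis cell to an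
`f`-twin: a `(ℤ/4)⁴`-invariant design with an off-axis cell contains an `f`-fibre pair on every factor. -/

def weight (k : Fin 4 → ZMod 4) : ℕ := (Finset.univ.filter fun f => k f ≠ 0).card

def InS0 (k : Fin 4 → ZMod 4) : Prop := k 0 + k 1 + k 2 + k 3 = 0

instance (k : Fin 4 → ZMod 4) : Decidable (InS0 k) := by unfold InS0; infer_instance

/-- no weight-one element in S₀: if exactly one coordinate is non-zero the coordinate sum is that coordinate. -/
theorem S0_no_weight_one (k : Fin 4 → ZMod 4) (hS : InS0 k) : weight k ≠ 1 := by
  classical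
  intro h1
  obtain ⟨f, hf⟩ := Finset.card_eq_one.mp h1
  have hz : ∀ g, g ≠ f → k g = 0 := by
    intro g hg; by_contra h
    have hm : g ∈ (Finset.univ.filter fun f => k f ≠ 0) := by simp [h]
    rw [hf, Finset.mem_singleton] at hm; exact hg hm
  have hf0 : k f ≠ 0 := by
    have hm : f ∈ (Finset.univ.filter fun f => k f ≠ 0) := by rw [hf]; simp
    simpa using hm
  have hsum : ∑ g, k g = k f := Finset.sum_eq_single f (fun g _ hg => hz g hg) (by simp)
  have hS' : ∑ g, k g = 0 := by simpa [InS0, Fin.sum_univ_four] using hS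
  rw [hsum] at hS'; exact hf0 hS'

/-- hence a non-zero element of S₀ moves at least two factors -/
theorem S0_weight_ge_two (k : Fin 4 → ZMod 4) (hS : InS0 k) (hk : k ≠ 0) : 2 ≤ weight k := by
  classical
  have hne := S0_no_weight_one k hS
  have hpos : weight k ≠ 0 := by
    obtain ⟨f, hf⟩ := Function.ne_iff.mp hk
    intro h0
    have hm : f ∈ (Finset.univ.filter fun f => k f ≠ 0) := by simpa using hf
    rw [weight, Finset.card_eq_zero] at h0
    rw [h0] at hm; simp at hm
  unfold weight at *; omega

/-- the full rotation group has the weight-one element `e₀` (and it is not in S₀) -/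
theorem full_group_has_weight_one : weight ![1,0,0,0] = 1 ∧ ¬ InS0 ![1,0,0,0] := by decide

/-- |S₀| = 64 (one free orbit of an off-axis cell = 64 cells, colour-1 ONE-ORBIT) -/
theorem card_S0 : (Finset.univ.filter fun k : Fin 4 → ZMod 4 => InS0 k).card = 64 := by decide

/-! ### (rev 1.2, critic rider w1) the corollary needs the base cell OFF-AXIS ON EVERY FACTOR.
FREE ROTATION MODEL: if on every factor the letter sits in a free `ℤ/4`-orbit (its `(b_f, c_f) ≠ (0,0)`, so the orbit position is a
coordinate in `ZMod 4` and the rest of the letter is untouched by rotation), rotating the cell by `k` changes EXACTLY the factors in `supp k`,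
so two cells of one S₀-orbit are at Hamming distance `weight k ≥ 2`.  If instead some factor `f₀` carries an ON-AXIS letter (a rotation
fixed point), `k = e_g − e_{f₀} ∈ S₀` moves only factor `g` and produces a `g`-twin (`onAxis_counterexample`): a free S₀-orbit of the CELL
is not enough, each LETTER must be moved. -/

/-- free model: rotation by `k` moves exactly the factors where `k ≠ 0`. -/
theorem hammingDist_add_eq_weight (x k : Fin 4 → ZMod 4) : hammingDist (x + k) x = weight k := by
  classical
  unfold hammingDist weight
  congr 1; ext f; simp

/-- hence, for a cell sloped on all four factors, S₀-rotations give distance ≥ 2: the orbit is a distance-2 code. -/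
theorem S0_orbit_distance_ge_two (x k : Fin 4 → ZMod 4) (hS : InS0 k) (hk : k ≠ 0) : 2 ≤ hammingDist (x + k) x := by
  rw [hammingDist_add_eq_weight]; exact S0_weight_ge_two k hS hk

/-- rotation with fixed points: factors flagged `onAxis` carry a rotation-fixed letter. -/
def rotateWithAxis (onAxis : Fin 4 → Bool) (x k : Fin 4 → ZMod 4) : Fin 4 → ZMod 4 :=
  fun f => if onAxis f then x f else x f + k f

/-- the critic's example: factor 3 on-axis, `k = e₀ − e₃ ∈ S₀`, and the rotated cell is a `0`-twin of the original (distance 1). -/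
theorem onAxis_counterexample :
    InS0 ![1, 0, 0, -1] ∧ hammingDist (rotateWithAxis (fun f => decide (f = 3)) 0 ![1, 0, 0, -1]) 0 = 1 := by decide

end RotationGroups

section Certificates
/-! ## §6  Digit certificates (script `line-14/code/fibrerow.py` cd844d20… on c4-1 loaders; two-term designs of record) and the CI test. -/

/-- ROW F kill predicate for a pooled class of cells: `S2(Φ) − r > L + L̄` (`r = 1` pure fibre, `r = h[k]` twins ⇒ use `h·S2, h`). -/
def RowFKills (S2 r L Lbar : ℕ) : Prop := L + Lbar + r < S2

instance (S2 r L Lbar : ℕ) : Decidable (RowFKills S2 r L Lbar) := by unfold RowFKills; infer_instance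

/-- RB16-plain c4c48e1e: the cross-side pair N((13,−1,0),(12,0,−2)³) / P((13,1,0),(12,0,−2)³) (f = 0; three more by symmetry):
S2 = 2, no f-zero / f-pure live arrow at either letter ⇒ one kernel class `ω₀ ⊗ (e_N + e_P)` — door-free, where Σ-DIAG = 0 and
KDEG = 2496 ≤ 5572 gave nothing and Σ-H needed the door (6080 > 5572). -/
theorem RB16_fibre_pair : RowFKills 2 1 0 0 ∧ ¬ RowFKills 1 1 0 0 := by decide

/-- bc5-plan g14 lifts of TW32b-p8-tw17b: lift0 5e8f898a (24 P-fibre pairs, margin 1) and lift0123 6353f711 (24 P-fibres of 16 letters,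
margin 15): pooled-only kills (each member passes its own ROW T: m = 1, no defects). -/
theorem tw17b_lift_fibres : RowFKills 2 1 0 0 ∧ RowFKills 16 1 0 0 ∧ (16 - 1 - 0 - 0 = 15) := by decide

/-- honesty: on a1a8405d (TW32b-p32-sharp) the pure cells are flooded by f-zero arrows (84 per factor): global pooled row
`(S2 − c_f) − L − L̄ = (160 − 53) − 840 − 24 < 0`, no fibre kill (the design is dead by Σ-H 19 584 and ROW (1,1) instead). -/
theorem a1a8405d_rowF_vacuous : (160 : ℤ) - 53 - 840 - 24 < 0 := by norm_num

/-- (viii) the complete-intersection test on a product `A₁ × A₂` of abelian surfaces, `W = D ∩ D′`, `c₁(D′) − c₁(D) = δ ⊠ 0` ample on `A₁`: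
`dim H¹(N_W) = 2·h^{0,2}(X) + 2·h⁰(δ) = 12 + 2h⁰(δ)` against `dim H³(Ω¹_X) = 16` — the dimension test is INCONCLUSIVE for `h⁰(δ) ≤ 2`,
where ROW F still gives the kernel vector `(ω₁, −ω₁)`. (`h^{0,2}(A₁×A₂) = 6`, `h^{1,3} = 4·4 = 16`.) -/
theorem ci_dimension_test_inconclusive :
    Nat.choose 4 2 = 6 ∧ 4 * 4 = 16 ∧ 12 + 2 * 1 ≤ 16 ∧ 12 + 2 * 2 ≤ 16 ∧ 16 < 12 + 2 * 3 := by decide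

/-- the seed frame: on `X = (E²)⁴`, `h^{0,2} = 28` splits as `4·1 + 6·4` over pure/mixed cells; ROW F charges `1` per pure fibre. -/
theorem h02_split : (pureKs.map hK).sum = 4 ∧ (mixedKs.map hK).sum = 24 ∧ 4 + 24 = Nat.choose 8 2 := by decide

end Certificates

section SlopeLetters
/-! ## §7 (rev 1.3)  Alphabet transfer — Mukai's simple semi-homogeneous letters (the «semihom alphabet» of `semihom-1` g0 §A:
letters `E_x` of rational slope `δ_x = c₁(E_x)/r(E_x) ∈ NS(A_f)_ℚ` per factor, boxes `⊠_f E_{x_f}`, masses `m_x`).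
For `E` simple semi-homogeneous on an abelian variety `X` (char 0): `H^j(𝒪_X) → H^j(End E)` induced by `id_E` is an isomorphism for
every `j` [Mukai1978, Prop 5.9 p.261; Thm 5.8 p.260], so `Diag_x[k] = H²(𝒪_X)[k] ⊗ End(ℂ^{m_x})` exactly as for line-bundle letters, and
the Atiyah class `At(E) ∈ H¹(Ω¹_X ⊗ End E) = H¹(Ω¹_X) ⊗ id_E` (Ω¹_X trivial) is `a ⊗ id_E`; the trace `tr At(E) = At(det E) = c₁(E)` gives
`r·a = c₁(E)`, i.e. `a = δ(E)` (`slope_of_trace`).  Hence `At(E_x)^q = δ_x^q ⊗ id` and LAW (ii) holds VERBATIM with `ch(L_x)` replaced by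
`ch(E_x) = r_x e^{δ_x}` [Mukai1978, Lemma 6.11 p.266]: `σ_q(ω ⊗ M) = ± tr(M) · r_x · ω ∪ δ_x^q/q!`.  Consequences: LAW (iv) with `c₁ ↦ δ`
(slope fibres: equal slopes off `f`), ROW F / ROW TW / (R1′) / the distance-2 code on SLOPE addresses verbatim (§3–§5 are stated over an
arbitrary alphabet `α` and an arbitrary functional `τ`), with ONE change: the kernel vectors are RANK-WEIGHTED — `r_{x′}·e_x − r_x·e_{x′}`
is killed by every `σ_q` (`rankWeighted_difference_eq_zero`), while the naive `e_x − e_{x′}` has `q = 0` component `(r_x − r_{x′})·ω ≠ 0`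
for letters of different rank (`naive_difference_ne_zero`); the pooled functional is `τ = Σ_x r_x tr(M_x)`, still of rank ≤ 1 per `ω`. -/

variable {R : Type*} [CommRing R]

/-- rank-weighted kernel vector of a slope fibre: with `ω·Δ = 0` (`Δ = δ_{x′} − δ_x` supported on the factor where `ω` is pure),
`r' (r ω δ^q) − r (r' ω (δ+Δ)^q) = 0` for every `q` — the characters `χ_x = r_x ω e^{δ_x}` are proportional. -/
theorem rankWeighted_difference_eq_zero (ω δ Δ r r' : R) (h : ω * Δ = 0) (q : ℕ) :
    r' * (r * (ω * δ ^ q)) - r * (r' * (ω * (δ + Δ) ^ q)) = 0 := by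
  rw [mul_add_pow_eq_of_mul_eq_zero ω δ Δ h q]; ring

/-- the `q = 0` component of the naive difference `e_x − e_{x′}` is `(r_x − r_{x′})·ω` … -/
theorem naive_difference_q0 (ω r r' : R) : r * (ω * 1) - r' * (ω * 1) = (r - r') * ω := by ring

/-- … which is nonzero for letters of different rank (`ω ≠ 0`): only the rank-weighted combination is a kernel vector. -/
theorem naive_difference_ne_zero {K : Type*} [Field K] (ω r r' : K) (hω : ω ≠ 0) (hr : r ≠ r') :
    r * (ω * 1) - r' * (ω * 1) ≠ 0 := by
  rw [naive_difference_q0]; exact mul_ne_zero (sub_ne_zero.mpr hr) hω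

/-- the trace step for the Atiyah class of a simple semi-homogeneous letter: `At = a ⊗ id_E` on rank `r` and `tr At = c₁` give
`a = c₁ / r = δ(E)` (characteristic 0). -/
theorem slope_of_trace {K : Type*} [Field K] [CharZero K] (r : ℕ) (hr : r ≠ 0) (a c₁ : K) (h : (r : K) * a = c₁) :
    a = c₁ / r := by
  have hr' : (r : K) ≠ 0 := Nat.cast_ne_zero.mpr hr
  rw [eq_div_iff hr', mul_comm]; exact h

/-- `ch_q(E) = r · δ^q / q!` versus `c₁(E)^q/q! = (r δ)^q/q!`: for `r ≥ 2` the letter character is NOT `ω ∪ c₁(E_x)^q/q!` —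
the dictionary is `c₁ ↦ δ`, not `c₁ ↦ c₁(E)` (degree 2, `r = 2`, `δ = 1`: `2·1 = 2 ≠ 4 = (2·1)²`). -/
theorem slope_not_c1_dictionary : (2 : ℚ) * 1 ^ 2 ≠ (2 * 1) ^ 2 := by norm_num

/-- Mukai's `Σ(E)` bookkeeping [Prop 7.1 p.269]: `End E ≅ ⊕_{ξ ∈ Σ(E)} P_ξ`, `|Σ(E)| = r²`, and only `ξ = 0` carries cohomology, so
`h^j(End E) = Σ_ξ [ξ = 0]·h^j(𝒪) = h^j(𝒪)`: the diagonal cell of a rank-`r` letter is no bigger than that of a line bundle. -/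
theorem sigmaE_only_trivial_character_counts {ι : Type*} [DecidableEq ι] (S : Finset ι) (ξ₀ : ι) (h0 : ξ₀ ∈ S) (hj : ℕ) :
    (S.sum fun ξ => if ξ = ξ₀ then hj else 0) = hj := by
  rw [Finset.sum_ite_eq' S ξ₀ (fun _ => hj)]; simp [h0]

end SlopeLetters


end Summit.HodgeConjecture.HodgeConjecture.Cruxes.BlochSeedDiscOne.FibreLaw
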